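import Mathlib
import HarnessLib

/-!
# Level-gap transport along two level curves (logarithmic Grönwall bound)

Crux `stmt-CriticalPhenomena-10269`
(`Summit.CriticalPhenomena.CardyFormulaZ2.Theses.CardySelfRefinement.GradientComparability`),
line **Sketch** (card `level-curve-window-transport`), stub `stub_levelGapTransport`.

Pure real analysis, nothing percolation-specific.  Two functions `cm < cp` on `[a, b]` both solve
the slope-field ODE `c' = -R(ρ, c)` with `R := Pρ / Pc` (two level curves of one smooth crossing
polynomial), and the slope `R(ρ, ·)` is `Θ`-Lipschitz on the vertical segment `[cm ρ, cp ρ]`.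
Then the gap `D := cp - cm > 0` has derivative `D' = -R(ρ, cp ρ) + R(ρ, cm ρ)` within `[a, b]`,
so `|D'| ≤ Θ · D`; hence `log D` has derivative `D' / D` of size at most `Θ`, the mean value
inequality on the convex set `[a, b]` makes `log D` `Θ`-Lipschitz there, and exponentiating gives
`D ρ ≤ exp (Θ |ρ - ρ'|) · D ρ'` for all `ρ, ρ' ∈ [a, b]`.
-/

noncomputable section

namespace Summit.CriticalPhenomena.CardyFormulaZ2.Theorems.CardySelfRefinement

open Set

/-- **Logarithmic Grönwall bound, Lipschitz form.** If `D > 0` on `[a, b]` has a derivative `D'`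
within `[a, b]` with `|D' ρ| ≤ Θ * D ρ`, then `log D` is `Θ`-Lipschitz on `[a, b]`
(mean value inequality applied to `log ∘ D`, whose derivative `D' / D` has size at most `Θ`). -/
theorem abs_log_sub_log_le_of_abs_deriv_le_mul {D D' : ℝ → ℝ} {a b Θ : ℝ}
    (hpos : ∀ ρ ∈ Icc a b, 0 < D ρ)
    (hder : ∀ ρ ∈ Icc a b, HasDerivWithinAt D (D' ρ) (Icc a b) ρ)
    (hbd : ∀ ρ ∈ Icc a b, |D' ρ| ≤ Θ * D ρ) {ρ ρ' : ℝ} (hρ : ρ ∈ Icc a b)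
    (hρ' : ρ' ∈ Icc a b) :
    |Real.log (D ρ) - Real.log (D ρ')| ≤ Θ * |ρ - ρ'| := by
  have hlog : ∀ x ∈ Icc a b,
      HasDerivWithinAt (fun y => Real.log (D y)) (D' x / D x) (Icc a b) x :=
    fun x hx => (hder x hx).log (hpos x hx).ne'
  have hbound : ∀ x ∈ Icc a b, ‖D' x / D x‖ ≤ Θ := by
    intro x hx
    rw [Real.norm_eq_abs, abs_div, abs_of_pos (hpos x hx), div_le_iff₀ (hpos x hx)]
    exact hbd x hx
  have h := (convex_Icc a b).norm_image_sub_le_of_norm_hasDerivWithin_le hlog hbound hρ' hρ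
  simpa only [Real.norm_eq_abs] using h

/-- **Logarithmic Grönwall bound, multiplicative form.** If `D > 0` on `[a, b]` has a derivative
`D'` within `[a, b]` with `|D' ρ| ≤ Θ * D ρ`, then `D ρ ≤ exp (Θ * |ρ - ρ'|) * D ρ'` for all
`ρ, ρ' ∈ [a, b]`. -/
theorem le_exp_mul_abs_sub_mul_of_abs_deriv_le_mul {D D' : ℝ → ℝ} {a b Θ : ℝ}
    (hpos : ∀ ρ ∈ Icc a b, 0 < D ρ)
    (hder : ∀ ρ ∈ Icc a b, HasDerivWithinAt D (D' ρ) (Icc a b) ρ)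
    (hbd : ∀ ρ ∈ Icc a b, |D' ρ| ≤ Θ * D ρ) {ρ ρ' : ℝ} (hρ : ρ ∈ Icc a b)
    (hρ' : ρ' ∈ Icc a b) :
    D ρ ≤ Real.exp (Θ * |ρ - ρ'|) * D ρ' := by
  have h := abs_log_sub_log_le_of_abs_deriv_le_mul hpos hder hbd hρ hρ'
  have h1 : Real.log (D ρ) ≤ Θ * |ρ - ρ'| + Real.log (D ρ') := by
    have h2 := (abs_sub_le_iff.1 h).1
    linarith
  calc D ρ = Real.exp (Real.log (D ρ)) := (Real.exp_log (hpos ρ hρ)).symm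
    _ ≤ Real.exp (Θ * |ρ - ρ'| + Real.log (D ρ')) := Real.exp_le_exp.2 h1
    _ = Real.exp (Θ * |ρ - ρ'|) * D ρ' := by rw [Real.exp_add, Real.exp_log (hpos ρ' hρ')]

/-- **Level-gap transport** (stub `stub_levelGapTransport` of line Sketch).  Two level curves
`cm < cp` on `[a, b]` of one smooth function, both solving the level-curve ODE `c' = -Pρ / Pc`
within `[a, b]`, with the slope `Pρ (ρ, ·) / Pc (ρ, ·)` being `Θ`-Lipschitz on the vertical
segment `[cm ρ, cp ρ]`: the vertical gap `cp - cm` changes by at most the factor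
`exp (Θ * |ρ - ρ'|)` between any two points `ρ, ρ'` of `[a, b]`. -/
theorem stub_levelGapTransport :
    ∀ (Pρ Pc : ℝ × ℝ → ℝ) (cm cp : ℝ → ℝ) (a b Θ : ℝ), a ≤ b → 0 ≤ Θ →
      (∀ ρ ∈ Set.Icc a b, cm ρ < cp ρ) →
      (∀ ρ ∈ Set.Icc a b, HasDerivWithinAt cp (-(Pρ (ρ, cp ρ) / Pc (ρ, cp ρ))) (Set.Icc a b) ρ) →
      (∀ ρ ∈ Set.Icc a b, HasDerivWithinAt cm (-(Pρ (ρ, cm ρ) / Pc (ρ, cm ρ))) (Set.Icc a b) ρ) →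
      (∀ ρ ∈ Set.Icc a b, ∀ c c' : ℝ, cm ρ ≤ c → c ≤ cp ρ → cm ρ ≤ c' → c' ≤ cp ρ →
        |Pρ (ρ, c) / Pc (ρ, c) - Pρ (ρ, c') / Pc (ρ, c')| ≤ Θ * |c - c'|) →
      ∀ ρ ∈ Set.Icc a b, ∀ ρ' ∈ Set.Icc a b,
        cp ρ - cm ρ ≤ Real.exp (Θ * |ρ - ρ'|) * (cp ρ' - cm ρ') := by
  intro Pρ Pc cm cp a b Θ _ _ hlt hcp hcm hLip ρ hρ ρ' hρ'
  have hpos : ∀ x ∈ Icc a b, 0 < cp x - cm x := fun x hx => sub_pos.2 (hlt x hx)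
  have hder : ∀ x ∈ Icc a b, HasDerivWithinAt (fun y => cp y - cm y)
      (-(Pρ (x, cp x) / Pc (x, cp x)) - -(Pρ (x, cm x) / Pc (x, cm x))) (Icc a b) x :=
    fun x hx => (hcp x hx).sub (hcm x hx)
  have hbd : ∀ x ∈ Icc a b,
      |-(Pρ (x, cp x) / Pc (x, cp x)) - -(Pρ (x, cm x) / Pc (x, cm x))| ≤ Θ * (cp x - cm x) := by
    intro x hx
    have h := hLip x hx (cp x) (cm x) (hlt x hx).le le_rfl le_rfl (hlt x hx).le
    rw [abs_of_pos (hpos x hx)] at h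
    calc |-(Pρ (x, cp x) / Pc (x, cp x)) - -(Pρ (x, cm x) / Pc (x, cm x))|
        = |Pρ (x, cp x) / Pc (x, cp x) - Pρ (x, cm x) / Pc (x, cm x)| := by
          rw [neg_sub_neg, abs_sub_comm]
      _ ≤ Θ * (cp x - cm x) := h
  exact le_exp_mul_abs_sub_mul_of_abs_deriv_le_mul (D := fun y => cp y - cm y)
    (D' := fun x => -(Pρ (x, cp x) / Pc (x, cp x)) - -(Pρ (x, cm x) / Pc (x, cm x)))
    hpos hder hbd hρ hρ'

end Summit.CriticalPhenomena.CardyFormulaZ2.Theorems.CardySelfRefinement
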